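import Summits.HodgeConjecture.HodgeConjecture.Theorems.H413HolThetaAtAdmissibleLine
import Summits.HodgeConjecture.HodgeConjecture.Theorems.H413ChiRowOfPinCharacter
import Summits.HodgeConjecture.HodgeConjecture.Theorems.H413ChiNArchPin
import Summits.HodgeConjecture.HodgeConjecture.Theorems.H413ChiNFinPin
import Summits.HodgeConjecture.HodgeConjecture.Theorems.H413PinLineCharacter
import Summits.HodgeConjecture.HodgeConjecture.Theorems.H413ThetaPairRepArchFinFactorisation
import Summits.HodgeConjecture.HodgeConjecture.Theorems.H413RallisTransportConsumption
import Summits.HodgeConjecture.HodgeConjecture.Theorems.H413ThetaDistAtLineArchTorusEigen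
import Summits.HodgeConjecture.HodgeCM.Model.ArchLineSlotTypeCont_1
import Summits.HodgeConjecture.HodgeCM.Model.ArchSideOfTwist
import Literature.NumberTheory.GelbartRogawski1991.UnitaryDualPairThetaLiftGaussianCharacter
import Literature.NumberTheory.Weil1964.ArchDualPairThetaMajorants
import Literature.NumberTheory.Weil1964.AdelicMetaplecticTwistGroup
import Literature.NumberTheory.Automorphic.AdelicPiSchwartzBruhatFourier
import Literature.NumberTheory.Automorphic.UnitaryGroupArchCompactTotallyComplex
import Literature.NumberTheory.Automorphic.AdelicGroupDataCompactMeasure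
import Literature.NumberTheory.Automorphic.UnitaryGroupRationalDiscrete
import Summits.HodgeConjecture.HodgeConjecture.Theorems.H413OmegaAtLineAdelicTwist
import HarnessLib

/-!
# Crux `H413`, programme P2 — Θ-OCC-GEN road (desk road Θ-GEN-P4, CENSUS-OCCGEN-B2 §3 R2 «χN-GEN»), brick (N6): THE PIN THETA LIFT NON-VANISHING
# ★ `ThetaJunction.pin_thetaLift_charCM_ne_zero` RE-TYPED AT A GENERAL PACKAGED FRAME — no `hDel`, no `[IsGalois ℚ F]`, no `6 ≤ [F:ℚ]`, no index of record

Cell hodgecm-mathlib (D-0151), FLOOR 0, crux item H413 = stmt-HodgeConjecture-24833; programme P2, sub-line `Cruxes/H413/Lines/F0_P2OccFlatGeneral.lean`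
ED. 1 (Θ-OCC-GEN, books #173); desk F0P2-plan (g12) CENSUS-OCCGEN-B2 §3: «R2 χN-GEN = the pin chain with `hemb`∕h6 replaced by (An)+(R1) and `t : datum413….Triple`
replaced by the loose data `(μ, hμ, hw, χ, e, he, a′, hae)` — every analytic input is ★ and frame-generic».  Author F0P2-p06 (g8).  `--supports stmt-HodgeConjecture-24833`.
DEF-FREE, theorems only, no `sorry`.

THIS FILE is ★ `H413PinThetaLiftNeZero` (F0P4-p03 (g3)) with EXACTLY these changes: the pin binders `(hDel) (F) [IsGalois ℚ F] (h6) (V) (a₀) (Φ) (i) (t) (hw) (hι) (e a he hae)`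
become the loose data `(F : HodgeCM.CMField) (V : HermSpace3 F ι₁) (h4 : 4 ≤ [F:ℚ]) (Φ : CMType F) (μ₀, hμ₀ : IsConjugateSymplectic, hw : HasWeight μ₀ 1)
(hmem : (mk ι₁).embedding ∈ Φ_{μ₀}) (χ : Chi) (e a he hae)`; `t.μ ↦ μ₀`, `t.χ ↦ χ`, `t.cmType ↦ hμ₀.cmType`; and the ONE pin-typed input (A-PIN) ★
`cmArchWeilRep_one_blockFamilyOfAt_pin` is replaced by its ★ GENERIC parent `ThetaDistAtLine.cmArchWeilRep_one_blockFamilyOfAt_eq_inv_twistChar_smul` fed with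
`hΦt` (admissibility ⇒ `Φ_{μ₀} = {φ ∣ Im φ(i·a) > 0}`, ★ `IsAdmissibleElement.mem_iff_im_pos`) and the ORIENTATION binder `hmem` (at the pin it came from the index of record,
★ `embedding_mk_eq_of_indexOfRecord`; off the pin it is R1 ORIENT-GEN's business).  Everything else — Rallis' identity `hRpin` (∀-closed, discharged by ★
`rallisInnerProductIdentity_pin_of_rankOneContCM` + ★ `hF_cm_splittingOf` in the consumer), brick 7, (FIN-PIN), the pin character `χ₂`, the measures — is the pin proof VERBATIM.

* **`thetaLift_charCM_ne_zero_gen`** — `∃ χ₂` (the pin character: `χ₂([h]) = ĉ(1 ⊗ h)⁻¹ · lineChar a χ (…h_f)`) `∃ Φ_f`, `Θ^{splittingOf hGR}_{linePhi ⊗ Φ_f}(charCM χ₂) ≠ 0`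
  against the pin measure, at ANY packaged frame `(F, V)` with `4 ≤ [F:ℚ]`, weight-one conjugate-symplectic `μ₀` oriented by `hmem`, admissible line `a = e·2i`.

HONEST LABEL: HC_CM is proved only modulo the 2 remaining named inputs (hLiu418, h413) until rung 0 closes; this file asserts nothing of print.

## References
* [Liu2021] Y. Liu, Camb. J. Math. 9 (2021), proof of Prop. 4.13 (l. 2145); Def. 4.12; App. D §D.1 Steps 1–3, Lem. D.2.
* [Li1992] J.-S. Li, J. reine angew. Math. 428 (1992), p. 178 and Thm 2.1 (26)–(27) p. 184; §5.
* [GelbartRogawski1991] S. Gelbart, J. Rogawski, Invent. Math. 105 (1991), §3.1 Prop. 3.1.1 p. 455; Remark p. 457 L4–13.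
-/

set_option autoImplicit false
set_option linter.dupNamespace false

noncomputable section

open MulAction NumberField NumberField.InfinitePlace NumberField.mixedEmbedding IsDedekindDomain
open _root_.MeasureTheory _root_.MeasureTheory.Measure
open scoped SchwartzMap TensorProduct Classical Matrix ComplexConjugate NNReal
open Literature.NumberTheory.Automorphic Literature.NumberTheory.Automorphic.UnitaryGroup Literature.NumberTheory.Weil1964
open Literature.NumberTheory.Weil1964.ThetaKernelDatum Literature.NumberTheory.Li1992
open Literature.Geometry.ComplexHyperbolic.BallModel (U21 x₀)
open Literature.AlgebraicGeometry.ShimuraVarieties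
open Literature.AlgebraicGeometry.Motives (CMType)
open Literature.NumberTheory.GelbartRogawski1991 Literature.NumberTheory.GelbartRogawski1991.UnitaryDualPair
open Literature.NumberTheory.GelbartRogawski1991.UnitaryDualPair.WeilCoinv (commute_comp_inl_comp_inr finPairToAdelic finPairRep)
open Literature.NumberTheory.Automorphic.Liu2021
open Literature.NumberTheory.Automorphic.Liu2021.Def411WeilCarriers (omegaAtLine rhoVAtLine Chi TW JW JW_eq isSymm_TW isUnit_det_TW lineChar locF)
open Literature.NumberTheory.Automorphic.Liu2021.Def411WeilCarriersDoubling
open Literature.NumberTheory.GaloisRepresentations (HeckeCharacter)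
open Literature.RepresentationTheory.HarrisKudlaSweet1996 (IsSplittingChar)
open Literature.RepresentationTheory.CompactGroups (charCM)
open Literature.MeasureTheory.Group
open HodgeCM HodgeCM.Adelic HodgeCM.PerL34 HodgeCM.Model HodgeCM.Model.ThetaSpace HodgeCM.Model.ArchSideTerm HodgeCM.Model.ThetaAdelicSide
open HodgeCM.Model.ThetaDistFin HodgeCM.Model.HypCensus HodgeCM.Model.LiuIndex HodgeCM.Model.TowerCarrier HodgeCM.Model.SupplyResidual
open HodgeCM.Model.SupplyResidual.WeilPairData (charInv charInv_apply)
open Literature.Analysis.SegalBargmann (binvPi)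
open Literature.AlgebraicGeometry.ShimuraVarieties (BallForms.isPullbackCocycle_cotangentCocycle BallForms.expP)
open Literature.AlgebraicGeometry.Liu2021 (IsAdmissibleElement)
open Summit.HodgeConjecture.CorCM Summit.HodgeConjecture.CorCM.Model Summit.HodgeConjecture.CorCM.Transposition
open Summit.HodgeConjecture.CorCM.Transposition.OmegaChiSplitting (hsChiD)
open Summit.HodgeConjecture.CorCM.Transposition.CentralTypeAtPin (hasCentralTypeAt_chiSplittingLine_toHeckeCharacter)
open Summit.HodgeConjecture.CorCM.Lines.A3Liu413 (datum413)
open Summit.HodgeConjecture.HodgeConjecture.Cruxes.H413.CohFormsCarriers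
open Summit.HodgeConjecture.HodgeConjecture.Cruxes.H413.CuspCot
open Summit.HodgeConjecture.HodgeConjecture.Cruxes.H413.ThetaDistAtLine
open Summit.HodgeConjecture.HodgeConjecture.Cruxes.H413.AdmissibleLine
open Summit.HodgeConjecture.HodgeConjecture.Cruxes.H413.IndexOrientation (embedding_mk_eq_of_indexOfRecord)
open Summit.HodgeConjecture.HodgeConjecture.Cruxes.H413.ThetaNonvanishing
open Summit.HodgeConjecture.HodgeConjecture.Cruxes.H413.RallisTransport

namespace Summit.HodgeConjecture.HodgeConjecture.Cruxes.H413.F0P2tThetaLiftNeZeroGen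

open Summit.HodgeConjecture.HodgeConjecture.Cruxes.H413.ThetaJunction

set_option synthInstance.maxHeartbeats 400000 in
set_option maxHeartbeats 8000000 in
/-- **THE PIN THETA LIFT NON-VANISHING AT A GENERAL PACKAGED FRAME.**  Under Rallis' identity (26) at the pin (`hRpin`, ∀-closed as in ★ `pin_thetaLift_charCM_ne_zero`), for
the LOOSE data `(F V h4 Φ μ₀ hμ₀ hw hmem χ e a he hae)` (see the module docstring), a real non-zero line scalar `a` with the slot sign `hpos`, the junction twist `ĉ` (`hĉ`, automorphic on
the line `hĉW`, continuous `hĉc`), ANY majorants `hρ` and stable `SK` of the pin pair representation: there is a continuous unitary character `χ₂` of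
`[U(⟨a⟩)]` with `χ₂([h]) = ĉ(1 ⊗ h)⁻¹ · lineChar a χ (subgroupCongr⁻¹ h_f)` and a finite test function `Φ_f` with
`Θ^{splittingOf hGR₀}_{linePhi ⊗ Φ_f}(charCM χ₂) ≠ 0` (theta lift against THE pin measure).
[cite: Li1992, p. 178 and Thm 2.1 (26)–(27) p. 184; §5] [cite: Liu2021, proof of Prop. 4.13 (l. 2145); App. D §D.1 Step 3, Lem. D.2]
[cite: GelbartRogawski1991, §3.1 Prop. 3.1.1 p. 455; Remark p. 457 L4–13] -/
theorem thetaLift_charCM_ne_zero_gen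
    (hRpin : ∀ (L : HodgeCM.CMField) {ι₁ : (L : Type) →+* ℂ} (V : HodgeCM.HermSpace3 L ι₁) (_h4 : 4 ≤ Module.finrank ℚ (L : Type))
      (a : (L : Type)) (ha : IsCMField.complexConj (L : Type) a = a) (ha0 : a ≠ 0)
      (hGR₀ : (cmSplittingDatum (L : Type) e₁ (frameD V) (frameD_real V) (frameD_ne V) (lineVec (L : Type) a)
        (fun _ => ha) (fun _ => ha0)).CompatibleSplitting)
      (hρ : HasThetaMajorants fun
        (p : CMAdelic (L : Type) (frameD V) × CMAdelic (L : Type) (lineVec (L : Type) a))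
        (Φ : piSchwartzBruhat (↥(maximalRealSubfield (L : Type))) (Fin 3)) =>
          cmPairRep (L : Type) e₁ (frameD V) (frameD_real V) (frameD_ne V) (lineVec (L : Type) a)
            (fun _ => ha) (fun _ => ha0) hGR₀ p Φ)
      (SK : Set (piSchwartzBruhat (↥(maximalRealSubfield (L : Type))) (Fin 3)))
      (hSK : ∀ (h : CMAdelic (L : Type) (lineVec (L : Type) a)) (Φ : piSchwartzBruhat (↥(maximalRealSubfield (L : Type))) (Fin 3)),
        Φ ∈ SK → cmPairRep (L : Type) e₁ (frameD V) (frameD_real V) (frameD_ne V) (lineVec (L : Type) a)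
          (fun _ => ha) (fun _ => ha0) hGR₀ (1, h) Φ ∈ SK)
      [MeasurableSpace (AdeleRing (𝓞 ↥(maximalRealSubfield (L : Type))) ↥(maximalRealSubfield (L : Type)))]
      [BorelSpace (AdeleRing (𝓞 ↥(maximalRealSubfield (L : Type))) ↥(maximalRealSubfield (L : Type)))]
      (νX : Measure (Fin 3 → AdeleRing (𝓞 ↥(maximalRealSubfield (L : Type))) ↥(maximalRealSubfield (L : Type)))) [νX.IsAddHaarMeasure]
      [MeasurableSpace (CMAdelic (L : Type) (lineVec (L : Type) a))] [BorelSpace (CMAdelic (L : Type) (lineVec (L : Type) a))]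
      (dh : Measure (CMAdelic (L : Type) (lineVec (L : Type) a))) [dh.IsHaarMeasure]
      [MeasurableSpace (CMAdelic (L : Type) (lineVec (L : Type) a) ⧸ CMRat (L : Type) (lineVec (L : Type) a))]
      [BorelSpace (CMAdelic (L : Type) (lineVec (L : Type) a) ⧸ CMRat (L : Type) (lineVec (L : Type) a))]
      [MeasurableSpace (CMAdelic (L : Type) (frameD V) ⧸ CMRat (L : Type) (frameD V))]
      [BorelSpace (CMAdelic (L : Type) (frameD V) ⧸ CMRat (L : Type) (frameD V))]
      (ν : Measure (CMAdelic (L : Type) (frameD V) ⧸ CMRat (L : Type) (frameD V))) [IsFiniteMeasure ν] [ν.IsOpenPosMeasure]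
      [SMulInvariantMeasure (CMAdelic (L : Type) (frameD V)) (CMAdelic (L : Type) (frameD V) ⧸ CMRat (L : Type) (frameD V)) ν]
      [CompactSpace (CMAdelic (L : Type) (frameD V) ⧸ CMRat (L : Type) (frameD V))],
      (cmThetaKernelDatum (L : Type) e₁ (frameD V) (frameD_real V) (frameD_ne V) (lineVec (L : Type) a)
          (fun _ => ha) (fun _ => ha0) hGR₀ hρ SK hSK).RallisInnerProductIdentity
        (schwartzPairing (↥(maximalRealSubfield (L : Type))) (Fin 3) νX) dh
        ((Literature.NumberTheory.Automorphic.probHaarRelNormOneQuot (↥(maximalRealSubfield (L : Type))) (L : Type)).map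
          (cosetCongr (cmLineTorusEquiv (L : Type) a ha0) (Literature.NumberTheory.Automorphic.relNormOneRat (↥(maximalRealSubfield (L : Type))) (L : Type))
            (CMRat (L : Type) (lineVec (L : Type) a)) (cmLineTorusEquiv_mem_CMRat_iff (L : Type) a ha0)))
        ν)
    (F : HodgeCM.CMField) {ι₁ : F →+* ℂ} (V : HodgeCM.HermSpace3 F ι₁) (h4 : 4 ≤ Module.finrank ℚ (F : Type)) (Φ : CMType F)
    (μ₀ : Literature.NumberTheory.Automorphic.IdeleClassGroup (HodgeCM.CMField.K F) →ₜ* Circle) (hμ₀ : Literature.NumberTheory.Automorphic.IdeleClassGroup.IsConjugateSymplectic (HodgeCM.CMField.K F) μ₀)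
    (hw : Literature.NumberTheory.Automorphic.IdeleClassGroup.HasWeight (HodgeCM.CMField.K F) μ₀ 1) (hmem : (InfinitePlace.mk ι₁).embedding ∈ hμ₀.cmType.1)
    (χ : Chi (↥(maximalRealSubfield (HodgeCM.CMField.K F))) (HodgeCM.CMField.K F) (IsCMField.complexConj (HodgeCM.CMField.K F)))
    (e : HodgeCM.CMField.K F) (a : (↥(maximalRealSubfield (HodgeCM.CMField.K F)))ˣ)
    (he : Literature.AlgebraicGeometry.Liu2021.IsAdmissibleElement (HodgeCM.CMField.K F) hμ₀.cmType.1 e)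
    (hae : ((a : ↥(maximalRealSubfield (HodgeCM.CMField.K F))) : (HodgeCM.CMField.K F)) = e * (2 * imagUnit (HodgeCM.CMField.K F)))
    (ha : IsCMField.complexConj (HodgeCM.CMField.K F) ((a : ↥(maximalRealSubfield (HodgeCM.CMField.K F))) : (HodgeCM.CMField.K F)) = ((a : ↥(maximalRealSubfield (HodgeCM.CMField.K F))) : (HodgeCM.CMField.K F))) (ha0 : ((a : ↥(maximalRealSubfield (HodgeCM.CMField.K F))) : (HodgeCM.CMField.K F)) ≠ 0)
    (hpos : 0 < cmXW (HodgeCM.CMField.K F) (frameD V) (lineVec (HodgeCM.CMField.K F) (dW (cDiag Φ ι₁ ((a : ↥(maximalRealSubfield (HodgeCM.CMField.K F))) : (HodgeCM.CMField.K F)) ha ha0).D 0))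
      (fun _ => dW_real (cDiag Φ ι₁ ((a : ↥(maximalRealSubfield (HodgeCM.CMField.K F))) : (HodgeCM.CMField.K F)) ha ha0).D 0) ι₁ (cmPlace (HodgeCM.CMField.K F) ι₁) 0)
    (ĉ : UnitaryGroup.adelicPair (↥(maximalRealSubfield (HodgeCM.CMField.K F))) (HodgeCM.CMField.K F) (IsCMField.complexConj (HodgeCM.CMField.K F)) 3 1
      (Matrix.diagonal (frameD V)) (Matrix.diagonal (lineVec (HodgeCM.CMField.K F) ((a : ↥(maximalRealSubfield (HodgeCM.CMField.K F))) : (HodgeCM.CMField.K F)))) →* ℂˣ)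
    (hĉ : chiSplitting (HodgeCM.CMField.K F) e₁ (frameD V) (frameD_real V) (frameD_ne V) (lineVec (HodgeCM.CMField.K F) ((a : ↥(maximalRealSubfield (HodgeCM.CMField.K F))) : (HodgeCM.CMField.K F)))
        (complexConj_lineVec_coe (HodgeCM.CMField.K F) a) (lineVec_coe_ne_zero (HodgeCM.CMField.K F) a)
        (Literature.NumberTheory.Automorphic.IdeleClassGroup.toHeckeCharacter (HodgeCM.CMField.K F) μ₀)
        (Literature.NumberTheory.Automorphic.IdeleClassGroup.isUnitary_toHeckeCharacter (HodgeCM.CMField.K F) μ₀)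
        ((Literature.RepresentationTheory.Liu2021.isOscillatorChar_toHeckeCharacter_iff μ₀).mpr hμ₀) =
      adelicMpCont.twist (↥(maximalRealSubfield (HodgeCM.CMField.K F))) (Fin 3) _
        (splittingOf _ _ _ _ _ _ _ _ _ _ _ _ _ _ _ _ _ (compat_line₀ V Φ ι₁ ((a : ↥(maximalRealSubfield (HodgeCM.CMField.K F))) : (HodgeCM.CMField.K F)) ha ha0)) ĉ)
    (hĉW : ∀ γ ∈ (UnitaryGroup.toAdelic (↥(maximalRealSubfield (HodgeCM.CMField.K F))) (HodgeCM.CMField.K F) (IsCMField.complexConj (HodgeCM.CMField.K F)) 1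
        (Matrix.diagonal (lineVec (HodgeCM.CMField.K F) ((a : ↥(maximalRealSubfield (HodgeCM.CMField.K F))) : (HodgeCM.CMField.K F))))).range,
      ĉ ((UnitaryGroup.adelicInr (↥(maximalRealSubfield (HodgeCM.CMField.K F))) (HodgeCM.CMField.K F) (IsCMField.complexConj (HodgeCM.CMField.K F)) 3 1
        (Matrix.diagonal (frameD V)) (Matrix.diagonal (lineVec (HodgeCM.CMField.K F) ((a : ↥(maximalRealSubfield (HodgeCM.CMField.K F))) : (HodgeCM.CMField.K F))))) γ) = 1)
    (hĉc : Continuous ĉ)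
    (hρ : HasThetaMajorants fun
      (p : CMAdelic (F : Type) (frameD V) × CMAdelic (F : Type) (lineVec (F : Type) ((a : ↥(maximalRealSubfield (HodgeCM.CMField.K F))) : (HodgeCM.CMField.K F))))
      (Φ' : piSchwartzBruhat (↥(maximalRealSubfield (F : Type))) (Fin 3)) =>
        cmPairRep (F : Type) e₁ (frameD V) (frameD_real V) (frameD_ne V) (lineVec (F : Type) ((a : ↥(maximalRealSubfield (HodgeCM.CMField.K F))) : (HodgeCM.CMField.K F))) (fun _ => ha) (fun _ => ha0)
          (compat_line₀ V Φ ι₁ ((a : ↥(maximalRealSubfield (HodgeCM.CMField.K F))) : (HodgeCM.CMField.K F)) ha ha0) p Φ')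
    (SK : Set (piSchwartzBruhat (↥(maximalRealSubfield (F : Type))) (Fin 3)))
    (hSK : ∀ (h : CMAdelic (F : Type) (lineVec (F : Type) ((a : ↥(maximalRealSubfield (HodgeCM.CMField.K F))) : (HodgeCM.CMField.K F)))) (Φ' : piSchwartzBruhat (↥(maximalRealSubfield (F : Type))) (Fin 3)),
      Φ' ∈ SK → cmPairRep (F : Type) e₁ (frameD V) (frameD_real V) (frameD_ne V) (lineVec (F : Type) ((a : ↥(maximalRealSubfield (HodgeCM.CMField.K F))) : (HodgeCM.CMField.K F))) (fun _ => ha) (fun _ => ha0)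
        (compat_line₀ V Φ ι₁ ((a : ↥(maximalRealSubfield (HodgeCM.CMField.K F))) : (HodgeCM.CMField.K F)) ha ha0) (1, h) Φ' ∈ SK)
    [MeasurableSpace (CMAdelic (F : Type) (lineVec (F : Type) ((a : ↥(maximalRealSubfield (HodgeCM.CMField.K F))) : (HodgeCM.CMField.K F))) ⧸ CMRat (F : Type) (lineVec (F : Type) ((a : ↥(maximalRealSubfield (HodgeCM.CMField.K F))) : (HodgeCM.CMField.K F))))]
    [BorelSpace (CMAdelic (F : Type) (lineVec (F : Type) ((a : ↥(maximalRealSubfield (HodgeCM.CMField.K F))) : (HodgeCM.CMField.K F))) ⧸ CMRat (F : Type) (lineVec (F : Type) ((a : ↥(maximalRealSubfield (HodgeCM.CMField.K F))) : (HodgeCM.CMField.K F))))]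
    [(CMRat (F : Type) (lineVec (F : Type) ((a : ↥(maximalRealSubfield (HodgeCM.CMField.K F))) : (HodgeCM.CMField.K F)))).Normal] [CompactSpace (CMAdelic (F : Type) (frameD V) ⧸ CMRat (F : Type) (frameD V))] :
    ∃ χ₂ : PontryaginDual (CMAdelic (F : Type) (lineVec (F : Type) ((a : ↥(maximalRealSubfield (HodgeCM.CMField.K F))) : (HodgeCM.CMField.K F))) ⧸ CMRat (F : Type) (lineVec (F : Type) ((a : ↥(maximalRealSubfield (HodgeCM.CMField.K F))) : (HodgeCM.CMField.K F)))),
      (∀ h : CMAdelic (F : Type) (lineVec (F : Type) ((a : ↥(maximalRealSubfield (HodgeCM.CMField.K F))) : (HodgeCM.CMField.K F))),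
        ((χ₂ (QuotientGroup.mk h) : Circle) : ℂ) =
          (((ĉ (UnitaryGroup.adelicInr (↥(maximalRealSubfield (HodgeCM.CMField.K F))) (HodgeCM.CMField.K F) (IsCMField.complexConj (HodgeCM.CMField.K F)) 3 1
              (Matrix.diagonal (frameD V)) (Matrix.diagonal (lineVec (HodgeCM.CMField.K F) ((a : ↥(maximalRealSubfield (HodgeCM.CMField.K F))) : (HodgeCM.CMField.K F)))) h))⁻¹ *
            lineChar (↥(maximalRealSubfield (HodgeCM.CMField.K F))) (HodgeCM.CMField.K F) (IsCMField.complexConj (HodgeCM.CMField.K F)) a χ.1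
              ((MulEquiv.subgroupCongr (finAdelic_JW_eq (HodgeCM.CMField.K F) a)).symm
                (UnitaryGroup.finPart (↥(maximalRealSubfield (HodgeCM.CMField.K F))) (HodgeCM.CMField.K F) (IsCMField.complexConj (HodgeCM.CMField.K F)) 1
                  (Matrix.diagonal (lineVec (HodgeCM.CMField.K F) ((a : ↥(maximalRealSubfield (HodgeCM.CMField.K F))) : (HodgeCM.CMField.K F)))) h)) : ℂˣ) : ℂ)) ∧
      ∃ Φf : FinSB (↥(maximalRealSubfield (HodgeCM.CMField.K F))) (Fin 3),
        (thetaKernelDatum (↥(maximalRealSubfield (HodgeCM.CMField.K F))) (HodgeCM.CMField.K F) (IsCMField.complexConj (HodgeCM.CMField.K F)) 3 1 e₁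
            (Matrix.diagonal (frameD V)) (Matrix.diagonal (lineVec (HodgeCM.CMField.K F) ((a : ↥(maximalRealSubfield (HodgeCM.CMField.K F))) : (HodgeCM.CMField.K F))))
            (complexConj_imagUnit (HodgeCM.CMField.K F)) (imagUnit_ne_zero (HodgeCM.CMField.K F)) (imagUnit_mul_self (HodgeCM.CMField.K F))
            (realDiagonal_isSymm (HodgeCM.CMField.K F) (frameD V) (frameD_real V))
            (realDiagonal_isSymm (HodgeCM.CMField.K F) (lineVec (HodgeCM.CMField.K F) ((a : ↥(maximalRealSubfield (HodgeCM.CMField.K F))) : (HodgeCM.CMField.K F))) (fun _ => ha))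
            (isUnit_det_realDiagonal (HodgeCM.CMField.K F) (frameD V) (frameD_real V) (frameD_ne V))
            (isUnit_det_realDiagonal (HodgeCM.CMField.K F) (lineVec (HodgeCM.CMField.K F) ((a : ↥(maximalRealSubfield (HodgeCM.CMField.K F))) : (HodgeCM.CMField.K F))) (fun _ => ha) (fun _ => ha0))
            (realDiagonal_map (HodgeCM.CMField.K F) (frameD V) (frameD_real V)).symm
            (realDiagonal_map (HodgeCM.CMField.K F) (lineVec (HodgeCM.CMField.K F) ((a : ↥(maximalRealSubfield (HodgeCM.CMField.K F))) : (HodgeCM.CMField.K F))) (fun _ => ha)).symm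
            (splittingOf _ _ _ _ _ _ _ _ _ _ _ _ _ _ _ _ _ (compat_line₀ V Φ ι₁ ((a : ↥(maximalRealSubfield (HodgeCM.CMField.K F))) : (HodgeCM.CMField.K F)) ha ha0))
            (splittingOf_isCompatible _ _ _ _ _ _ _ _ _ _ _ _ _ _ _ _ _ (compat_line₀ V Φ ι₁ ((a : ↥(maximalRealSubfield (HodgeCM.CMField.K F))) : (HodgeCM.CMField.K F)) ha ha0)) hρ SK hSK).thetaLift
          ((Literature.NumberTheory.Automorphic.probHaarRelNormOneQuot (↥(maximalRealSubfield (HodgeCM.CMField.K F))) (HodgeCM.CMField.K F)).map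
            (cosetCongr (cmLineTorusEquiv (HodgeCM.CMField.K F) ((a : ↥(maximalRealSubfield (HodgeCM.CMField.K F))) : (HodgeCM.CMField.K F)) ha0)
              (Literature.NumberTheory.Automorphic.relNormOneRat (↥(maximalRealSubfield (HodgeCM.CMField.K F))) (HodgeCM.CMField.K F))
              (CMRat (F : Type) (lineVec (F : Type) ((a : ↥(maximalRealSubfield (HodgeCM.CMField.K F))) : (HodgeCM.CMField.K F)))) (cmLineTorusEquiv_mem_CMRat_iff (HodgeCM.CMField.K F) ((a : ↥(maximalRealSubfield (HodgeCM.CMField.K F))) : (HodgeCM.CMField.K F)) ha0)))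
          (piSchwartzBruhatEquiv (↥(maximalRealSubfield (HodgeCM.CMField.K F))) (Fin 3) (linePhi V ((a : ↥(maximalRealSubfield (HodgeCM.CMField.K F))) : (HodgeCM.CMField.K F)) ha ha0 hpos ⊗ₜ[ℂ] Φf))
          (charCM χ₂) ≠ 0 := by
  -- (0) the line scalar, the CM line datum at the pin (slot `0` of the diagonal context), degree, compactness, normality
  haveI hcW : CompactSpace (CMAdelic (F : Type) (lineVec (F : Type) ((a : ↥(maximalRealSubfield (HodgeCM.CMField.K F))) : (HodgeCM.CMField.K F))) ⧸
      CMRat (F : Type) (lineVec (F : Type) ((a : ↥(maximalRealSubfield (HodgeCM.CMField.K F))) : (HodgeCM.CMField.K F)))) :=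
    compactSpace_quotient_range_toAdelic_line (F : Type) _ (fun _ => ha) (fun _ => ha0)
  -- (1) σ-algebras: Borel everywhere
  haveI := Literature.NumberTheory.Automorphic.secondCountableTopology_adeleRing (↥(maximalRealSubfield (HodgeCM.CMField.K F)))
  haveI := Literature.NumberTheory.Automorphic.secondCountableTopology_finiteAdeleRing (↥(maximalRealSubfield (HodgeCM.CMField.K F)))
  haveI := locallyCompactSpace_finiteAdeleRing' (↥(maximalRealSubfield (HodgeCM.CMField.K F)))
  haveI := locallyCompactSpace_adeleRing' (↥(maximalRealSubfield (HodgeCM.CMField.K F)))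
  borelize (AdeleRing (𝓞 ↥(maximalRealSubfield (HodgeCM.CMField.K F))) ↥(maximalRealSubfield (HodgeCM.CMField.K F)))
    (FiniteAdeleRing (𝓞 ↥(maximalRealSubfield (HodgeCM.CMField.K F))) ↥(maximalRealSubfield (HodgeCM.CMField.K F)))
    (CMAdelic (F : Type) (frameD V))
    ↥(UnitaryGroup.arch (↥(maximalRealSubfield (HodgeCM.CMField.K F))) (HodgeCM.CMField.K F) (IsCMField.complexConj (HodgeCM.CMField.K F)) 1
      (Matrix.diagonal (lineVec (HodgeCM.CMField.K F) ((a : ↥(maximalRealSubfield (HodgeCM.CMField.K F))) : (HodgeCM.CMField.K F)))))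
    ↥(UnitaryGroup.finAdelic (↥(maximalRealSubfield (HodgeCM.CMField.K F))) (HodgeCM.CMField.K F) (IsCMField.complexConj (HodgeCM.CMField.K F)) 1
      (Matrix.diagonal (lineVec (HodgeCM.CMField.K F) ((a : ↥(maximalRealSubfield (HodgeCM.CMField.K F))) : (HodgeCM.CMField.K F)))))
  haveI : BorelSpace (Fin 3 → mixedSpace (↥(maximalRealSubfield (HodgeCM.CMField.K F)))) := Pi.borelSpace
  haveI : BorelSpace (Fin 3 → FiniteAdeleRing (𝓞 ↥(maximalRealSubfield (HodgeCM.CMField.K F))) ↥(maximalRealSubfield (HodgeCM.CMField.K F))) :=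
    Pi.borelSpace
  haveI : BorelSpace (Fin 3 → AdeleRing (𝓞 ↥(maximalRealSubfield (HodgeCM.CMField.K F))) ↥(maximalRealSubfield (HodgeCM.CMField.K F))) :=
    Pi.borelSpace
  letI mW : MeasurableSpace (CMAdelic (F : Type) (lineVec (F : Type) ((a : ↥(maximalRealSubfield (HodgeCM.CMField.K F))) : (HodgeCM.CMField.K F)))) := borel _
  haveI : BorelSpace (CMAdelic (F : Type) (lineVec (F : Type) ((a : ↥(maximalRealSubfield (HodgeCM.CMField.K F))) : (HodgeCM.CMField.K F)))) := ⟨rfl⟩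
  letI : MeasurableSpace (UnitaryGroup.adelicGroupData (↥(maximalRealSubfield (HodgeCM.CMField.K F))) (HodgeCM.CMField.K F)
      (IsCMField.complexConj (HodgeCM.CMField.K F)) 1
      (Matrix.diagonal (lineVec (HodgeCM.CMField.K F) ((a : ↥(maximalRealSubfield (HodgeCM.CMField.K F))) : (HodgeCM.CMField.K F))))).Adelic := mW
  haveI : BorelSpace (UnitaryGroup.adelicGroupData (↥(maximalRealSubfield (HodgeCM.CMField.K F))) (HodgeCM.CMField.K F)
      (IsCMField.complexConj (HodgeCM.CMField.K F)) 1
      (Matrix.diagonal (lineVec (HodgeCM.CMField.K F) ((a : ↥(maximalRealSubfield (HodgeCM.CMField.K F))) : (HodgeCM.CMField.K F))))).Adelic := ⟨rfl⟩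
  haveI : LocallyCompactSpace (CMAdelic (F : Type) (frameD V)) :=
    UnitaryGroup.locallyCompactSpace_cmDatum_Adelic (F : Type) 3 (Matrix.diagonal (frameD V))
  haveI : SecondCountableTopology (CMAdelic (F : Type) (frameD V)) :=
    UnitaryGroup.secondCountableTopology_cmDatum_Adelic (F : Type) 3 (Matrix.diagonal (frameD V))
  haveI : T2Space (CMAdelic (F : Type) (frameD V)) := UnitaryGroup.t2Space_cmDatum_Adelic (F : Type) 3 (Matrix.diagonal (frameD V))
  haveI : DiscreteTopology (CMRat (F : Type) (frameD V)) := UnitaryGroup.adelicGroupData_isDiscreteRational (F : Type) 3 (Matrix.diagonal (frameD V))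
  have hVcl : IsClosed ((CMRat (F : Type) (frameD V) : Subgroup (CMAdelic (F : Type) (frameD V))) : Set (CMAdelic (F : Type) (frameD V))) :=
    Subgroup.isClosed_of_discrete
  haveI : BorelSpace (CMAdelic (F : Type) (frameD V) ⧸ CMRat (F : Type) (frameD V)) := borelSpace_quotient _ hVcl
  haveI : LocallyCompactSpace (CMAdelic (F : Type) (lineVec (F : Type) ((a : ↥(maximalRealSubfield (HodgeCM.CMField.K F))) : (HodgeCM.CMField.K F)))) :=
    UnitaryGroup.locallyCompactSpace_cmDatum_Adelic (F : Type) 1 _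
  haveI hca : CompactSpace (UnitaryGroup.arch (↥(maximalRealSubfield (HodgeCM.CMField.K F))) (HodgeCM.CMField.K F)
      (IsCMField.complexConj (HodgeCM.CMField.K F)) 1
      (Matrix.diagonal (lineVec (HodgeCM.CMField.K F) ((a : ↥(maximalRealSubfield (HodgeCM.CMField.K F))) : (HodgeCM.CMField.K F))))) :=
    UnitaryGroup.compactSpace_arch_rankOne (↥(maximalRealSubfield (HodgeCM.CMField.K F))) (HodgeCM.CMField.K F)
      (IsCMField.complexConj (HodgeCM.CMField.K F)) _ (complexConj_imagUnit (HodgeCM.CMField.K F)) (imagUnit_ne_zero (HodgeCM.CMField.K F))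
      (isUnit_det_realDiagonal (HodgeCM.CMField.K F) (lineVec (HodgeCM.CMField.K F) ((a : ↥(maximalRealSubfield (HodgeCM.CMField.K F))) : (HodgeCM.CMField.K F)))
        (fun _ => ha) (fun _ => ha0))
      (realDiagonal_map (HodgeCM.CMField.K F) (lineVec (HodgeCM.CMField.K F) ((a : ↥(maximalRealSubfield (HodgeCM.CMField.K F))) : (HodgeCM.CMField.K F)))
        (fun _ => ha)).symm
  -- (2) the measures
  set μE : Measure (Fin 3 → mixedSpace (↥(maximalRealSubfield (HodgeCM.CMField.K F)))) := Measure.addHaar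
  set μfX : Measure (Fin 3 → FiniteAdeleRing (𝓞 ↥(maximalRealSubfield (HodgeCM.CMField.K F))) ↥(maximalRealSubfield (HodgeCM.CMField.K F))) :=
    Measure.addHaar
  set νX : Measure (Fin 3 → AdeleRing (𝓞 ↥(maximalRealSubfield (HodgeCM.CMField.K F))) ↥(maximalRealSubfield (HodgeCM.CMField.K F))) :=
    Measure.addHaar
  obtain ⟨cX, hcX, hνX⟩ := exists_haar_eq_smul_map_prod (↥(maximalRealSubfield (HodgeCM.CMField.K F))) (Fin 3) νX μE μfX
  set dh : Measure (CMAdelic (F : Type) (lineVec (F : Type) ((a : ↥(maximalRealSubfield (HodgeCM.CMField.K F))) : (HodgeCM.CMField.K F)))) :=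
    Measure.haar with hdh
  have hdhH : dh.IsHaarMeasure := by rw [hdh]; infer_instance
  haveI : @Measure.IsHaarMeasure (UnitaryGroup.adelicGroupData (↥(maximalRealSubfield (HodgeCM.CMField.K F))) (HodgeCM.CMField.K F)
      (IsCMField.complexConj (HodgeCM.CMField.K F)) 1
      (Matrix.diagonal (lineVec (HodgeCM.CMField.K F) ((a : ↥(maximalRealSubfield (HodgeCM.CMField.K F))) : (HodgeCM.CMField.K F))))).Adelic _ _ _ dh := hdhH
  haveI := UnitaryGroup.isHaarMeasure_map_finPart (↥(maximalRealSubfield (HodgeCM.CMField.K F))) (HodgeCM.CMField.K F)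
      (IsCMField.complexConj (HodgeCM.CMField.K F)) 1
      (Matrix.diagonal (lineVec (HodgeCM.CMField.K F) ((a : ↥(maximalRealSubfield (HodgeCM.CMField.K F))) : (HodgeCM.CMField.K F)))) dh
  -- (3) a finite invariant open-positive measure on `[U(V)]`
  obtain ⟨τ, hτ⟩ := UnitaryGroup.exists_infinitePlace_ne (F : Type) h4 ι₁
  obtain ⟨ν, hνfin, hνpos, hνinv⟩ :=
    exists_smulInvariantMeasure_quotient_range_toAdelic (F : Type) (frameD V) (frameD_real V) τ (frameD_sign_of_ne V τ hτ)
  haveI := hνfin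
  haveI := hνpos
  haveI := hνinv
  -- (5) RALLIS AT THE PIN
  have hR := hRpin F V h4 _ ha ha0 (compat_line₀ V Φ ι₁ ((a : ↥(maximalRealSubfield (HodgeCM.CMField.K F))) : (HodgeCM.CMField.K F)) ha ha0)
    hρ SK hSK νX dh ν
  -- (6) THE PIN CHARACTER `χ₂` of `[U(⟨a⟩)]` (junction twist inverted × Liu's `χ` on the line) and its finite part `χf`
  obtain ⟨χ₂, hχ₂⟩ := exists_pinDual (HodgeCM.CMField.K F) (Matrix.diagonal (frameD V)) a ĉ hĉW hĉc χ
  obtain ⟨χf, hχf_def⟩ : ∃ χf : UnitaryGroup.finAdelic (↥(maximalRealSubfield (HodgeCM.CMField.K F))) (HodgeCM.CMField.K F)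
      (IsCMField.complexConj (HodgeCM.CMField.K F)) 1
      (Matrix.diagonal (lineVec (HodgeCM.CMField.K F) ((a : ↥(maximalRealSubfield (HodgeCM.CMField.K F))) : (HodgeCM.CMField.K F)))) →* ℂˣ,
      χf = Circle.toUnits.comp ((χ₂.toMonoidHom).comp ((QuotientGroup.mk' (CMRat (F : Type)
      (lineVec (HodgeCM.CMField.K F) ((a : ↥(maximalRealSubfield (HodgeCM.CMField.K F))) : (HodgeCM.CMField.K F))))).comp
      (UnitaryGroup.finAdelicToAdelic (↥(maximalRealSubfield (HodgeCM.CMField.K F))) (HodgeCM.CMField.K F)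
        (IsCMField.complexConj (HodgeCM.CMField.K F)) 1
        (Matrix.diagonal (lineVec (HodgeCM.CMField.K F) ((a : ↥(maximalRealSubfield (HodgeCM.CMField.K F))) : (HodgeCM.CMField.K F))))))) := ⟨_, rfl⟩
  have hχf_apply : ∀ b, ((χf b : ℂˣ) : ℂ) =
      ((χ₂ (QuotientGroup.mk (UnitaryGroup.finAdelicToAdelic (↥(maximalRealSubfield (HodgeCM.CMField.K F))) (HodgeCM.CMField.K F)
        (IsCMField.complexConj (HodgeCM.CMField.K F)) 1
        (Matrix.diagonal (lineVec (HodgeCM.CMField.K F) ((a : ↥(maximalRealSubfield (HodgeCM.CMField.K F))) : (HodgeCM.CMField.K F)))) b)) : Circle) : ℂ) :=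
    fun b => by rw [hχf_def]; rfl
  have hχfc : Continuous fun b => ((χf b : ℂˣ) : ℂ) := by
    simp_rw [hχf_apply]
    exact continuous_subtype_val.comp ((map_continuous χ₂).comp ((QuotientGroup.continuous_mk).comp
      (UnitaryGroup.continuous_finAdelicToAdelic _ _ _ _ _)))
  have hχfu : ∀ b, ‖((χf b : ℂˣ) : ℂ)‖ = 1 := fun b => by rw [hχf_apply]; exact Circle.norm_coe _
  -- (7) (FIN-PIN): one non-zero finite Fourier coefficient at the chosen splitting, weight `conj χf`
  obtain ⟨Φf, hfin⟩ := exists_finCoeff_ne_zero_cm_splittingOf (HodgeCM.CMField.K F) e₁ (frameD V) (frameD_real V) (frameD_ne V)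
    (lineVec (HodgeCM.CMField.K F) ((a : ↥(maximalRealSubfield (HodgeCM.CMField.K F))) : (HodgeCM.CMField.K F))) (fun _ => ha) (fun _ => ha0)
    le_rfl (compat_line₀ V Φ ι₁ ((a : ↥(maximalRealSubfield (HodgeCM.CMField.K F))) : (HodgeCM.CMField.K F)) ha ha0) μfX (dh.map (UnitaryGroup.finPart _ _ _ _ _)) χf hχfc hχfu
  -- (8) (A-PIN): the harmonic vector `Φ_∞ = linePhi` of the line at `ℓ = ⟨e₀, ·⟩` is an `archWeilRep`-eigenvector with eigencharacter `χ₂|_∞`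
  have hχ₂arch : ∀ a' : UnitaryGroup.arch (↥(maximalRealSubfield (HodgeCM.CMField.K F))) (HodgeCM.CMField.K F)
      (IsCMField.complexConj (HodgeCM.CMField.K F)) 1
      (Matrix.diagonal (lineVec (HodgeCM.CMField.K F) ((a : ↥(maximalRealSubfield (HodgeCM.CMField.K F))) : (HodgeCM.CMField.K F)))),
      ((χ₂ (QuotientGroup.mk (UnitaryGroup.archToAdelic (↥(maximalRealSubfield (HodgeCM.CMField.K F))) (HodgeCM.CMField.K F)
        (IsCMField.complexConj (HodgeCM.CMField.K F)) 1
        (Matrix.diagonal (lineVec (HodgeCM.CMField.K F) ((a : ↥(maximalRealSubfield (HodgeCM.CMField.K F))) : (HodgeCM.CMField.K F)))) a')) : Circle) : ℂ) =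
      (((ĉ (UnitaryGroup.adelicInr (↥(maximalRealSubfield (HodgeCM.CMField.K F))) (HodgeCM.CMField.K F) (IsCMField.complexConj (HodgeCM.CMField.K F)) 3 1
          (Matrix.diagonal (frameD V)) (Matrix.diagonal (lineVec (HodgeCM.CMField.K F) ((a : ↥(maximalRealSubfield (HodgeCM.CMField.K F))) : (HodgeCM.CMField.K F))))
          (UnitaryGroup.archToAdelic (↥(maximalRealSubfield (HodgeCM.CMField.K F))) (HodgeCM.CMField.K F) (IsCMField.complexConj (HodgeCM.CMField.K F)) 1
            (Matrix.diagonal (lineVec (HodgeCM.CMField.K F) ((a : ↥(maximalRealSubfield (HodgeCM.CMField.K F))) : (HodgeCM.CMField.K F)))) a')))⁻¹ : ℂˣ) : ℂ) := by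
    intro a'
    rw [hχ₂, UnitaryGroup.finPart_archToAdelic, map_one, map_one, mul_one]
  have heig : ∀ a' : UnitaryGroup.arch (↥(maximalRealSubfield (HodgeCM.CMField.K F))) (HodgeCM.CMField.K F)
      (IsCMField.complexConj (HodgeCM.CMField.K F)) 1
      (Matrix.diagonal (lineVec (HodgeCM.CMField.K F) ((a : ↥(maximalRealSubfield (HodgeCM.CMField.K F))) : (HodgeCM.CMField.K F)))),
      archWeilRep (↥(maximalRealSubfield (HodgeCM.CMField.K F))) (HodgeCM.CMField.K F) (IsCMField.complexConj (HodgeCM.CMField.K F)) 3 1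
        (Matrix.diagonal (frameD V)) (Matrix.diagonal (lineVec (HodgeCM.CMField.K F) ((a : ↥(maximalRealSubfield (HodgeCM.CMField.K F))) : (HodgeCM.CMField.K F))))
        (complexConj_imagUnit (HodgeCM.CMField.K F)) (imagUnit_ne_zero (HodgeCM.CMField.K F)) (imagUnit_mul_self (HodgeCM.CMField.K F))
        (realDiagonal_isSymm (HodgeCM.CMField.K F) (frameD V) (frameD_real V))
        (realDiagonal_isSymm (HodgeCM.CMField.K F) (lineVec (HodgeCM.CMField.K F) ((a : ↥(maximalRealSubfield (HodgeCM.CMField.K F))) : (HodgeCM.CMField.K F))) (fun _ => ha))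
        (isUnit_det_realDiagonal (HodgeCM.CMField.K F) (frameD V) (frameD_real V) (frameD_ne V))
        (isUnit_det_realDiagonal (HodgeCM.CMField.K F) (lineVec (HodgeCM.CMField.K F) ((a : ↥(maximalRealSubfield (HodgeCM.CMField.K F))) : (HodgeCM.CMField.K F))) (fun _ => ha) (fun _ => ha0))
        (realDiagonal_map (HodgeCM.CMField.K F) (frameD V) (frameD_real V)).symm
        (realDiagonal_map (HodgeCM.CMField.K F) (lineVec (HodgeCM.CMField.K F) ((a : ↥(maximalRealSubfield (HodgeCM.CMField.K F))) : (HodgeCM.CMField.K F))) (fun _ => ha)).symm e₁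
        (splittingOf _ _ _ _ _ _ _ _ _ _ _ _ _ _ _ _ _ (compat_line₀ V Φ ι₁ ((a : ↥(maximalRealSubfield (HodgeCM.CMField.K F))) : (HodgeCM.CMField.K F)) ha ha0))
        (proj_apply_eq_toSp (↥(maximalRealSubfield (HodgeCM.CMField.K F))) (HodgeCM.CMField.K F) (IsCMField.complexConj (HodgeCM.CMField.K F)) 3 1 e₁
          _ _ _ _ _ _ _ _ _ _ _
          (splittingOf_isCompatible _ _ _ _ _ _ _ _ _ _ _ _ _ _ _ _ _ (compat_line₀ V Φ ι₁ ((a : ↥(maximalRealSubfield (HodgeCM.CMField.K F))) : (HodgeCM.CMField.K F)) ha ha0)))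
        (1, a') (linePhi V ((a : ↥(maximalRealSubfield (HodgeCM.CMField.K F))) : (HodgeCM.CMField.K F)) ha ha0 hpos) =
      (((ĉ (UnitaryGroup.adelicInr (↥(maximalRealSubfield (HodgeCM.CMField.K F))) (HodgeCM.CMField.K F) (IsCMField.complexConj (HodgeCM.CMField.K F)) 3 1
          (Matrix.diagonal (frameD V)) (Matrix.diagonal (lineVec (HodgeCM.CMField.K F) ((a : ↥(maximalRealSubfield (HodgeCM.CMField.K F))) : (HodgeCM.CMField.K F))))
          (UnitaryGroup.archToAdelic (↥(maximalRealSubfield (HodgeCM.CMField.K F))) (HodgeCM.CMField.K F) (IsCMField.complexConj (HodgeCM.CMField.K F)) 1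
            (Matrix.diagonal (lineVec (HodgeCM.CMField.K F) ((a : ↥(maximalRealSubfield (HodgeCM.CMField.K F))) : (HodgeCM.CMField.K F)))) a')))⁻¹ : ℂˣ) : ℂ) •
        linePhi V ((a : ↥(maximalRealSubfield (HodgeCM.CMField.K F))) : (HodgeCM.CMField.K F)) ha ha0 hpos :=
    fun a' => cmArchWeilRep_one_blockFamilyOfAt_eq_inv_twistChar_smul V ((a : ↥(maximalRealSubfield (HodgeCM.CMField.K F))) : (HodgeCM.CMField.K F)) ha ha0
      (compat_line₀ V Φ ι₁ ((a : ↥(maximalRealSubfield (HodgeCM.CMField.K F))) : (HodgeCM.CMField.K F)) ha ha0) μ₀ hμ₀ hw hμ₀.hasCMType_cmType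
      (fun φ => by
        rw [hae]
        exact Summit.HodgeConjecture.HodgeConjecture.Cruxes.H413.AdmissibleLine.IsAdmissibleElement.mem_iff_im_pos hμ₀.cmType he (complexConj_imagUnit _) (imagUnit_ne_zero _) φ)
      hmem ĉ hĉ (posIdxEquivUnit hpos) (negIdxEquivEmpty hpos) a' (dotProductEquiv ℂ (Fin 2) (Pi.single 0 1))
  -- `χ_∞ := (ĉ ∘ ι_W ∘ (·)_𝔸)⁻¹` is unitary (it is `χ₂|_∞`)
  have hχu : ∀ a' : UnitaryGroup.arch (↥(maximalRealSubfield (HodgeCM.CMField.K F))) (HodgeCM.CMField.K F)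
      (IsCMField.complexConj (HodgeCM.CMField.K F)) 1
      (Matrix.diagonal (lineVec (HodgeCM.CMField.K F) ((a : ↥(maximalRealSubfield (HodgeCM.CMField.K F))) : (HodgeCM.CMField.K F)))),
      (((ĉ (UnitaryGroup.adelicInr (↥(maximalRealSubfield (HodgeCM.CMField.K F))) (HodgeCM.CMField.K F) (IsCMField.complexConj (HodgeCM.CMField.K F)) 3 1
          (Matrix.diagonal (frameD V)) (Matrix.diagonal (lineVec (HodgeCM.CMField.K F) ((a : ↥(maximalRealSubfield (HodgeCM.CMField.K F))) : (HodgeCM.CMField.K F))))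
          (UnitaryGroup.archToAdelic (↥(maximalRealSubfield (HodgeCM.CMField.K F))) (HodgeCM.CMField.K F) (IsCMField.complexConj (HodgeCM.CMField.K F)) 1
            (Matrix.diagonal (lineVec (HodgeCM.CMField.K F) ((a : ↥(maximalRealSubfield (HodgeCM.CMField.K F))) : (HodgeCM.CMField.K F)))) a')))⁻¹ : ℂˣ) : ℂ) *
        conj (((ĉ (UnitaryGroup.adelicInr (↥(maximalRealSubfield (HodgeCM.CMField.K F))) (HodgeCM.CMField.K F) (IsCMField.complexConj (HodgeCM.CMField.K F)) 3 1
          (Matrix.diagonal (frameD V)) (Matrix.diagonal (lineVec (HodgeCM.CMField.K F) ((a : ↥(maximalRealSubfield (HodgeCM.CMField.K F))) : (HodgeCM.CMField.K F))))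
          (UnitaryGroup.archToAdelic (↥(maximalRealSubfield (HodgeCM.CMField.K F))) (HodgeCM.CMField.K F) (IsCMField.complexConj (HodgeCM.CMField.K F)) 1
            (Matrix.diagonal (lineVec (HodgeCM.CMField.K F) ((a : ↥(maximalRealSubfield (HodgeCM.CMField.K F))) : (HodgeCM.CMField.K F)))) a')))⁻¹ : ℂˣ) : ℂ) = 1 :=
    fun a' => by rw [← hχ₂arch a']; exact coe_mk_archToAdelic_mul_conj _ _ _ _ _ χ₂ a'
  -- `⟨Φ_∞, Φ_∞⟩_∞ ≠ 0`
  have hΦ := integral_linePhi_mul_conj_ne_zero V (d := ((a : ↥(maximalRealSubfield (HodgeCM.CMField.K F))) : (HodgeCM.CMField.K F)))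
    (hd := ha) (hd0 := ha0) hpos μE
  -- the `∞ ⊔ f` reading of `χ₂`
  have hχw : ∀ h : CMAdelic (F : Type) (lineVec (F : Type) ((a : ↥(maximalRealSubfield (HodgeCM.CMField.K F))) : (HodgeCM.CMField.K F))),
      conj ((χ₂ (QuotientGroup.mk h) : Circle) : ℂ) =
        conj (((ĉ (UnitaryGroup.adelicInr (↥(maximalRealSubfield (HodgeCM.CMField.K F))) (HodgeCM.CMField.K F) (IsCMField.complexConj (HodgeCM.CMField.K F)) 3 1
          (Matrix.diagonal (frameD V)) (Matrix.diagonal (lineVec (HodgeCM.CMField.K F) ((a : ↥(maximalRealSubfield (HodgeCM.CMField.K F))) : (HodgeCM.CMField.K F))))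
          (UnitaryGroup.archToAdelic (↥(maximalRealSubfield (HodgeCM.CMField.K F))) (HodgeCM.CMField.K F) (IsCMField.complexConj (HodgeCM.CMField.K F)) 1
            (Matrix.diagonal (lineVec (HodgeCM.CMField.K F) ((a : ↥(maximalRealSubfield (HodgeCM.CMField.K F))) : (HodgeCM.CMField.K F))))
            (UnitaryGroup.archPart (↥(maximalRealSubfield (HodgeCM.CMField.K F))) (HodgeCM.CMField.K F)
              (IsCMField.complexConj (HodgeCM.CMField.K F)) 1 _ h))))⁻¹ : ℂˣ) : ℂ) *
          conj ((χf (UnitaryGroup.finPart (↥(maximalRealSubfield (HodgeCM.CMField.K F))) (HodgeCM.CMField.K F)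
            (IsCMField.complexConj (HodgeCM.CMField.K F)) 1 _ h) : ℂˣ) : ℂ) := fun h => by
    rw [hχf_apply, ← hχ₂arch]
    exact conj_coe_mk_eq_arch_mul_fin _ _ _ _ _ χ₂ h
  -- the pin measure `(cosetCongr e)_* probHaar` on `[U(⟨a⟩)]` is finite and charges open sets
  haveI hμpos : ((Literature.NumberTheory.Automorphic.probHaarRelNormOneQuot (↥(maximalRealSubfield (HodgeCM.CMField.K F))) (HodgeCM.CMField.K F)).map
      (cosetCongr (cmLineTorusEquiv (HodgeCM.CMField.K F) ((a : ↥(maximalRealSubfield (HodgeCM.CMField.K F))) : (HodgeCM.CMField.K F)) ha0)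
        (Literature.NumberTheory.Automorphic.relNormOneRat (↥(maximalRealSubfield (HodgeCM.CMField.K F))) (HodgeCM.CMField.K F))
        (CMRat (F : Type) (lineVec (F : Type) ((a : ↥(maximalRealSubfield (HodgeCM.CMField.K F))) : (HodgeCM.CMField.K F))))
        (cmLineTorusEquiv_mem_CMRat_iff (HodgeCM.CMField.K F) ((a : ↥(maximalRealSubfield (HodgeCM.CMField.K F))) : (HodgeCM.CMField.K F)) ha0))).IsOpenPosMeasure :=
    isOpenPosMeasure_map_cosetCongr _ _ _ _
      (continuous_cmLineTorusEquiv (HodgeCM.CMField.K F) ((a : ↥(maximalRealSubfield (HodgeCM.CMField.K F))) : (HodgeCM.CMField.K F)) ha0)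
      (continuous_cmLineTorusEquiv_symm (HodgeCM.CMField.K F) ((a : ↥(maximalRealSubfield (HodgeCM.CMField.K F))) : (HodgeCM.CMField.K F)) ha0) _
  -- (9) BRICK 7: the theta lift of `Φ_∞ ⊗ Φ_f` at the pin splitting, tested against `charCM χ₂`, is non-zero
  have hlift := (Summit.HodgeConjecture.HodgeConjecture.Cruxes.H413.ThetaNonvanishing.thetaLift_charCM_tmul_ne_zero_of_finCoeff_ne_zero (↥(maximalRealSubfield (HodgeCM.CMField.K F))) (HodgeCM.CMField.K F)
    (IsCMField.complexConj (HodgeCM.CMField.K F)) 3 1 e₁ (Matrix.diagonal (frameD V))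
    (Matrix.diagonal (lineVec (HodgeCM.CMField.K F) ((a : ↥(maximalRealSubfield (HodgeCM.CMField.K F))) : (HodgeCM.CMField.K F))))
    (complexConj_imagUnit (HodgeCM.CMField.K F)) (imagUnit_ne_zero (HodgeCM.CMField.K F)) (imagUnit_mul_self (HodgeCM.CMField.K F))
    (realDiagonal_isSymm (HodgeCM.CMField.K F) (frameD V) (frameD_real V))
    (realDiagonal_isSymm (HodgeCM.CMField.K F) (lineVec (HodgeCM.CMField.K F) ((a : ↥(maximalRealSubfield (HodgeCM.CMField.K F))) : (HodgeCM.CMField.K F))) (fun _ => ha))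
    (isUnit_det_realDiagonal (HodgeCM.CMField.K F) (frameD V) (frameD_real V) (frameD_ne V))
    (isUnit_det_realDiagonal (HodgeCM.CMField.K F) (lineVec (HodgeCM.CMField.K F) ((a : ↥(maximalRealSubfield (HodgeCM.CMField.K F))) : (HodgeCM.CMField.K F))) (fun _ => ha) (fun _ => ha0))
    (realDiagonal_map (HodgeCM.CMField.K F) (frameD V) (frameD_real V)).symm
    (realDiagonal_map (HodgeCM.CMField.K F) (lineVec (HodgeCM.CMField.K F) ((a : ↥(maximalRealSubfield (HodgeCM.CMField.K F))) : (HodgeCM.CMField.K F))) (fun _ => ha)).symm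
    (splittingOf_isCompatible _ _ _ _ _ _ _ _ _ _ _ _ _ _ _ _ _ (compat_line₀ V Φ ι₁ ((a : ↥(maximalRealSubfield (HodgeCM.CMField.K F))) : (HodgeCM.CMField.K F)) ha ha0))
    dh Measure.haar (dh.map (UnitaryGroup.finPart _ _ _ _ _)) hρ SK hSK _ ν hνX hcX.ne' hR χ₂
    hχu hχw heig hΦ hfin).1
  exact ⟨χ₂, hχ₂, Φf, hlift⟩

end Summit.HodgeConjecture.HodgeConjecture.Cruxes.H413.F0P2tThetaLiftNeZeroGen

end
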